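import Summits.RiemannHypothesis.RiemannHypothesis.Theorems.UniversalFactorNarrowKernelNoGoEnergyLowerTerms
import Summits.RiemannHypothesis.RiemannHypothesis.Theorems.UniversalFactorNarrowKernelNoGoEnergyLowerKernel
import Literature.NumberTheory.LFunctions.ZetaMeanSquareLowerBound

/-!
# RiemannHypothesis / UniversalFactor — `NarrowKernelNoGo`, line `Sketch`, stub K1a (energy lower
bound): the shifted Hardy function against the test polynomial on one block

Route `RiemannHypothesis/UniversalFactor`, crux `NarrowKernelNoGo` (stmt-RiemannHypothesis-2576), stub
`UniversalFactor.stub_narrowEnergyLowerClean` (lead). For a block `B = [T', T' + U]`, a shift `u` and a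
test polynomial `D(t) = Σ_{n≤P} a_n n^{it}` put `Inner(u) := ∫_B Z(t+u) conj(E₁ t) D(t) dt`. Using
`Z = E₁ S_P + conj(E₁ S_P) + e_P` (`TwistedMoment.hardyZErr`, an identity) and the three term bounds of
`…EnergyLowerTerms`, this file proves

* `UniversalFactor.narrowInner_decomp` — the four-term decomposition of `Inner(u)`;
* `UniversalFactor.narrowInner_main_le` — for `|u| ≤ u₀ ≤ T'/2`, `2πP² ≤ T' − u₀`:
  `‖Inner(u) − e^{iuL} U Σ a_n n^{-1/2} e^{−iu log n}‖ ≤ (bilinear MV) + (phase defect) + (van der Corput)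
  + (AFE error by AM–GM)`, `L = ½ log(T'/2π)`;
* `UniversalFactor.narrowInner_crude_le` — the trivial bound `‖Inner(u)‖ ≤ U (2 + 2(T'+U) + 2|u|) Σ‖a_n‖`;
* `UniversalFactor.narrowSmooth_continuous` — continuity of the smoothed Hardy function
  `t ↦ ∫ κ_a(u) Z(t+u) du`.

References: Titchmarsh (1986) §7.3–7.4, §9.20.
-/

noncomputable section

-- D-0017: `Summit.<S>.<S>.…` is the designed namespace of a single-problem summit.
set_option linter.dupNamespace false

namespace Summit.RiemannHypothesis.RiemannHypothesis.Theorems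

open MeasureTheory Set Filter Complex intervalIntegral
open scoped Real Topology ComplexConjugate
open Literature.NumberTheory.LFunctions Literature.NumberTheory.LFunctions.TwistedMoment

/-! ## Continuity of the smoothed Hardy function -/

/-- **Continuity of the smoothed Hardy function** `t ↦ ∫ κ_a(u) Z(t+u) du` (`a > π/8`). [folklore] -/
theorem UniversalFactor.narrowSmooth_continuous {a : ℝ} (ha : π / 8 < a) :
    Continuous fun t : ℝ => ∫ u : ℝ, Real.exp (-(2 * a * |u|)) * Real.exp (-(π * u / 4)) * hardyZ (t + u) := by
  refine continuous_iff_continuousAt.2 fun t₀ => ?_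
  have hint := UniversalFactor.narrow_integrable_pow_mul_ker ha 1
  refine continuousAt_of_dominated (bound := fun u => (2 + 2 * (|t₀| + 1)) *
      ((1 + |u|) ^ 1 * (Real.exp (-(2 * a * |u|)) * Real.exp (-(π * u / 4))))) ?_ ?_ ?_ ?_
  · refine Eventually.of_forall fun t => ?_
    exact (((UniversalFactor.continuous_narrowKer a).mul
      (continuous_hardyZ.comp (continuous_const.add continuous_id))).aestronglyMeasurable)
  · have hball : Metric.ball t₀ 1 ∈ 𝓝 t₀ := Metric.ball_mem_nhds t₀ one_pos
    filter_upwards [hball] with t ht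
    refine Eventually.of_forall fun u => ?_
    rw [Real.norm_eq_abs, pow_one]
    refine UniversalFactor.abs_narrowKer_mul_hardyZ_le ?_
    have : dist t t₀ < 1 := ht
    rw [Real.dist_eq] at this
    have := abs_sub_abs_le_abs_sub t t₀
    linarith
  · exact hint.const_mul _
  · refine Eventually.of_forall fun u => ?_
    exact ((continuous_const.mul (continuous_hardyZ.comp (continuous_id.add continuous_const))).continuousAt)

/-! ## The decomposition of `Inner(u)` -/

/-- Hardy's function through its first approximation: `Z(τ) = E₁(τ)S_P(τ) + conj(E₁(τ)S_P(τ)) + e_P(τ)`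
(the DEFINITION of `hardyZErr`). [cite: Titchmarsh1986, §9.20] -/
theorem UniversalFactor.hardyZ_eq_first_approx (P : ℕ) (τ : ℝ) :
    (hardyZ τ : ℂ) = thetaMainPhase τ * mainSum P τ + conj (thetaMainPhase τ * mainSum P τ) + hardyZErr P τ := by
  rw [hardyZErr]; ring

/-- The integrand of `Inner(u)` splits into the frozen diagonal part, the phase defect, the cross term
and the AFE error. [folklore] -/
theorem UniversalFactor.narrowInner_integrand_eq (P : ℕ) (D : ℝ → ℂ) (L t u : ℝ) :
    (hardyZ (t + u) : ℂ) * (conj (thetaMainPhase t) * D t) =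
      cexp (I * u * L) * (D t * mainSum P (t + u)) +
      (thetaMainPhase (t + u) * conj (thetaMainPhase t) - cexp (I * u * L)) * (D t * mainSum P (t + u)) +
      conj (thetaMainPhase (t + u) * thetaMainPhase t) * conj (mainSum P (t + u)) * D t +
      hardyZErr P (t + u) * conj (thetaMainPhase t) * D t := by
  rw [UniversalFactor.hardyZ_eq_first_approx P (t + u)]
  simp only [map_mul]
  ring

/-- Every point of the block is positive, and so is its shift (`−T'/2 ≤ u`). [folklore] -/
theorem UniversalFactor.narrowBlock_pos {T' U u t : ℝ} (hT' : 0 < T') (hU : 0 ≤ U) (hu : -(T' / 2) ≤ u)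
    (ht : t ∈ uIcc T' (T' + U)) : 0 < t ∧ 0 < t + u := by
  rw [uIcc_of_le (by linarith)] at ht
  constructor <;> linarith [ht.1]

/-- Continuity on the block of the pieces (for interval integrability). [folklore] -/
theorem UniversalFactor.narrowBlock_continuousOn_pieces (P : ℕ) (a : ℕ → ℂ) {T' U u : ℝ} (hT' : 0 < T')
    (hU : 0 ≤ U) (hu : -(T' / 2) ≤ u) :
    ContinuousOn (fun t => thetaMainPhase t) (uIcc T' (T' + U)) ∧
    ContinuousOn (fun t => thetaMainPhase (t + u)) (uIcc T' (T' + U)) ∧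
    ContinuousOn (fun t => mainSum P (t + u)) (uIcc T' (T' + U)) ∧
    ContinuousOn (fun t : ℝ => ∑ n ∈ Finset.Icc 1 P, a n * (n : ℂ) ^ ((t : ℂ) * I)) (uIcc T' (T' + U)) ∧
    ContinuousOn (fun t => hardyZErr P (t + u)) (uIcc T' (T' + U)) := by
  have h1 : ContinuousOn (fun t => thetaMainPhase t) (uIcc T' (T' + U)) :=
    continuousOn_thetaMainPhase.mono fun t ht => (UniversalFactor.narrowBlock_pos hT' hU hu ht).1
  have h2 : ContinuousOn (fun t => thetaMainPhase (t + u)) (uIcc T' (T' + U)) :=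
    continuousOn_thetaMainPhase.comp (continuous_id.add continuous_const).continuousOn
      fun t ht => (UniversalFactor.narrowBlock_pos hT' hU hu ht).2
  have h3 : ContinuousOn (fun t => mainSum P (t + u)) (uIcc T' (T' + U)) :=
    ((continuous_mainSum P).comp (continuous_id.add continuous_const)).continuousOn
  have h4 : ContinuousOn (fun t : ℝ => ∑ n ∈ Finset.Icc 1 P, a n * (n : ℂ) ^ ((t : ℂ) * I)) (uIcc T' (T' + U)) :=
    (continuous_dirichletPoly P a).continuousOn
  refine ⟨h1, h2, h3, h4, ?_⟩
  have hZ : ContinuousOn (fun t => (hardyZ (t + u) : ℂ)) (uIcc T' (T' + U)) :=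
    (Complex.continuous_ofReal.comp (continuous_hardyZ.comp (continuous_id.add continuous_const))).continuousOn
  have : (fun t => hardyZErr P (t + u)) = fun t => (hardyZ (t + u) : ℂ) - thetaMainPhase (t + u) * mainSum P (t + u)
      - conj (thetaMainPhase (t + u) * mainSum P (t + u)) := by
    funext t; rw [hardyZErr]
  rw [this]
  exact (hZ.sub (h2.mul h3)).sub (Complex.continuous_conj.comp_continuousOn (h2.mul h3))

/-- **Main estimate for `Inner(u)`** (`|u| ≤ u₀ ≤ T'/2`, `2πP² ≤ T' − u₀`, test coefficients supported
where `8πν² ≤ T'`): with `L = ½ log(T'/2π)`, `D(t) = Σ a_n n^{it}`,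
`‖Inner(u) − e^{iuL}·U·Σ a_n n^{-1/2} e^{−iu log n}‖ ≤ 3712(P + Σ n‖a_n‖²)
  + (|u|(U+|u|)/T')·(∫_B‖D‖² + ∫_B‖S_P(·+u)‖²)/2 + (2/log 2)(Σ_{μ≤P} μ^{-1/2})(Σ‖a_n‖)
  + (η ∫_B‖e_P(·+u)‖² + (∫_B‖D‖²)/η)/2`. [folklore] -/
theorem UniversalFactor.narrowInner_main_le (P : ℕ) (a : ℕ → ℂ) {T' U u u₀ η : ℝ} (hT' : 0 < T') (hU : 0 ≤ U)
    (hu₀T : u₀ ≤ T' / 2) (hu : |u| ≤ u₀) (hη : 0 < η) (hP : 2 * π * (P : ℝ) ^ 2 ≤ T' - u₀)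
    (ha : ∀ ν ∈ Finset.Icc 1 P, a ν ≠ 0 → 8 * π * (ν : ℝ) ^ 2 ≤ T') :
    ‖(∫ t in T'..(T' + U), (hardyZ (t + u) : ℂ) *
        (conj (thetaMainPhase t) * ∑ n ∈ Finset.Icc 1 P, a n * (n : ℂ) ^ ((t : ℂ) * I))) -
        cexp (I * u * ((Real.log (T' / (2 * π)) / 2 : ℝ) : ℂ)) * (U * ∑ n ∈ Finset.Icc 1 P,
          a n * ((((n : ℝ) ^ (-(1 / 2 : ℝ)) : ℝ) : ℂ) * cexp (-(I * u * Real.log n))))‖ ≤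
      3712 * ((P : ℝ) + ∑ n ∈ Finset.Icc 1 P, (n : ℝ) * ‖a n‖ ^ 2) +
      |u| * (U + |u|) / T' * ((∫ t in T'..(T' + U), ‖∑ n ∈ Finset.Icc 1 P, a n * (n : ℂ) ^ ((t : ℂ) * I)‖ ^ 2) +
        ∫ t in T'..(T' + U), ‖mainSum P (t + u)‖ ^ 2) / 2 +
      2 / Real.log 2 * (∑ μ ∈ Finset.Icc 1 P, (μ : ℝ) ^ (-(1 / 2 : ℝ))) * (∑ ν ∈ Finset.Icc 1 P, ‖a ν‖) +
      (η * (∫ t in T'..(T' + U), ‖hardyZErr P (t + u)‖ ^ 2) +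
        (∫ t in T'..(T' + U), ‖∑ n ∈ Finset.Icc 1 P, a n * (n : ℂ) ^ ((t : ℂ) * I)‖ ^ 2) / η) / 2 := by
  have hle : T' ≤ T' + U := by linarith
  have hu' : -(T' / 2) ≤ u := by linarith [neg_abs_le u, hu.trans hu₀T]
  have hu₀ : 0 ≤ u₀ := (abs_nonneg u).trans hu
  set L : ℝ := Real.log (T' / (2 * π)) / 2 with hL
  set D : ℝ → ℂ := fun t => ∑ n ∈ Finset.Icc 1 P, a n * (n : ℂ) ^ ((t : ℂ) * I) with hD
  set θ : ℝ → ℂ := fun t => thetaMainPhase (t + u) * conj (thetaMainPhase t) - cexp (I * u * L) with hθ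
  obtain ⟨hE, hEu, hS, hDc, he⟩ := UniversalFactor.narrowBlock_continuousOn_pieces P a hT' hU hu' (u := u)
  -- the four pieces are interval integrable
  have hi1 : IntervalIntegrable (fun t => cexp (I * u * L) * (D t * mainSum P (t + u))) volume T' (T' + U) :=
    (continuousOn_const.mul (hDc.mul hS)).intervalIntegrable
  have hi2 : IntervalIntegrable (fun t => θ t * (D t * mainSum P (t + u))) volume T' (T' + U) :=
    (((hEu.mul (Complex.continuous_conj.comp_continuousOn hE)).sub continuousOn_const).mul (hDc.mul hS)).intervalIntegrable
  have hi3 : IntervalIntegrable (fun t => conj (thetaMainPhase (t + u) * thetaMainPhase t) *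
      conj (mainSum P (t + u)) * D t) volume T' (T' + U) :=
    (((Complex.continuous_conj.comp_continuousOn (hEu.mul hE)).mul
      (Complex.continuous_conj.comp_continuousOn hS)).mul hDc).intervalIntegrable
  have hi4 : IntervalIntegrable (fun t => hardyZErr P (t + u) * conj (thetaMainPhase t) * D t) volume T' (T' + U) :=
    ((he.mul (Complex.continuous_conj.comp_continuousOn hE)).mul hDc).intervalIntegrable
  -- rewrite the integral as the sum of four integrals
  have hsplit : (∫ t in T'..(T' + U), (hardyZ (t + u) : ℂ) * (conj (thetaMainPhase t) * D t)) =
      cexp (I * u * L) * (∫ t in T'..(T' + U), D t * mainSum P (t + u)) +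
      (∫ t in T'..(T' + U), θ t * (D t * mainSum P (t + u))) +
      (∫ t in T'..(T' + U), conj (thetaMainPhase (t + u) * thetaMainPhase t) * conj (mainSum P (t + u)) * D t) +
      ∫ t in T'..(T' + U), hardyZErr P (t + u) * conj (thetaMainPhase t) * D t := by
    have heq : ∀ t, (hardyZ (t + u) : ℂ) * (conj (thetaMainPhase t) * D t) =
        cexp (I * u * L) * (D t * mainSum P (t + u)) + θ t * (D t * mainSum P (t + u)) +
        conj (thetaMainPhase (t + u) * thetaMainPhase t) * conj (mainSum P (t + u)) * D t +
        hardyZErr P (t + u) * conj (thetaMainPhase t) * D t := fun t =>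
      UniversalFactor.narrowInner_integrand_eq P D L t u
    simp_rw [heq]
    rw [intervalIntegral.integral_add ((hi1.add hi2).add hi3) hi4,
      intervalIntegral.integral_add (hi1.add hi2) hi3, intervalIntegral.integral_add hi1 hi2,
      intervalIntegral.integral_const_mul]
  -- the frozen main term
  have hA := UniversalFactor.narrowTermA_frozen_le P a u T' (T' + U)
  have hU' : ((T' + U : ℝ) : ℂ) - (T' : ℂ) = (U : ℂ) := by push_cast; ring
  rw [hU'] at hA
  -- the phase defect
  have hθc : ContinuousOn θ (Icc T' (T' + U)) := by
    rw [← uIcc_of_le hle]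
    exact (hEu.mul (Complex.continuous_conj.comp_continuousOn hE)).sub continuousOn_const
  have hθb : ∀ t ∈ Icc T' (T' + U), ‖θ t‖ ≤ |u| * (U + |u|) / T' := by
    intro t ht
    simp only [hθ]
    rw [UniversalFactor.thetaMainPhase_shift_mul_conj,
      show I * (u : ℂ) * (L : ℂ) = I * ((u * L : ℝ) : ℂ) by push_cast; ring]
    have hph := UniversalFactor.narrowPhase_shift_sub_linear_le hT' hU ht.1 ht.2 (hu.trans hu₀T)
    refine (UniversalFactor.norm_cexp_I_sub_cexp_I_le _ _).trans ?_
    simpa only [hL] using hph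
  have hB := UniversalFactor.narrowTermA_phase_le P a (u := u) hle (by positivity) hθc hθb
  -- the cross term
  have hP' : 2 * π * (P : ℝ) ^ 2 ≤ T' + u := by linarith [neg_abs_le u]
  have hC := UniversalFactor.narrowTermB_le P a hT' hU hu' hP' ha
  -- the AFE error
  have hEc : ContinuousOn (fun t => hardyZErr P (t + u) * conj (thetaMainPhase t)) (Icc T' (T' + U)) := by
    rw [← uIcc_of_le hle]; exact he.mul (Complex.continuous_conj.comp_continuousOn hE)
  have hDc' : ContinuousOn D (Icc T' (T' + U)) := (continuous_dirichletPoly P a).continuousOn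
  have hE' := UniversalFactor.narrow_norm_integral_mul_le_amgm hle hη hEc hDc'
  have hnormE : ∀ t ∈ Icc T' (T' + U), ‖hardyZErr P (t + u) * conj (thetaMainPhase t)‖ = ‖hardyZErr P (t + u)‖ := by
    intro t _
    rw [norm_mul, Complex.norm_conj, norm_thetaMainPhase, mul_one]
  have hE'' : ∫ t in T'..(T' + U), ‖hardyZErr P (t + u) * conj (thetaMainPhase t)‖ ^ 2 =
      ∫ t in T'..(T' + U), ‖hardyZErr P (t + u)‖ ^ 2 := by
    refine intervalIntegral.integral_congr fun t ht => ?_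
    rw [uIcc_of_le hle] at ht
    simp only [hnormE t ht]
  rw [hE''] at hE'
  have hE4 : ∫ t in T'..(T' + U), hardyZErr P (t + u) * conj (thetaMainPhase t) * D t =
      ∫ t in T'..(T' + U), (hardyZErr P (t + u) * conj (thetaMainPhase t)) * D t := rfl
  -- assemble with the triangle inequality
  rw [hsplit]
  have key : cexp (I * u * L) * (∫ t in T'..(T' + U), D t * mainSum P (t + u)) +
      (∫ t in T'..(T' + U), θ t * (D t * mainSum P (t + u))) +
      (∫ t in T'..(T' + U), conj (thetaMainPhase (t + u) * thetaMainPhase t) * conj (mainSum P (t + u)) * D t) +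
      (∫ t in T'..(T' + U), hardyZErr P (t + u) * conj (thetaMainPhase t) * D t) -
      cexp (I * u * L) * (U * ∑ n ∈ Finset.Icc 1 P,
          a n * ((((n : ℝ) ^ (-(1 / 2 : ℝ)) : ℝ) : ℂ) * cexp (-(I * u * Real.log n)))) =
      cexp (I * u * L) * ((∫ t in T'..(T' + U), D t * mainSum P (t + u)) - U * ∑ n ∈ Finset.Icc 1 P,
          a n * ((((n : ℝ) ^ (-(1 / 2 : ℝ)) : ℝ) : ℂ) * cexp (-(I * u * Real.log n)))) +
      (∫ t in T'..(T' + U), θ t * (D t * mainSum P (t + u))) +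
      (∫ t in T'..(T' + U), conj (thetaMainPhase (t + u) * thetaMainPhase t) * conj (mainSum P (t + u)) * D t) +
      (∫ t in T'..(T' + U), hardyZErr P (t + u) * conj (thetaMainPhase t) * D t) := by ring
  rw [key]
  have hphase : ‖cexp (I * u * L)‖ = 1 := by
    rw [show I * (u : ℂ) * (L : ℂ) = ((u * L : ℝ) : ℂ) * I by push_cast; ring, Complex.norm_exp_ofReal_mul_I]
  refine (norm_add_le _ _).trans ?_
  refine (add_le_add (norm_add_le _ _) le_rfl).trans ?_
  refine (add_le_add (add_le_add (norm_add_le _ _) le_rfl) le_rfl).trans ?_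
  rw [norm_mul, hphase, one_mul]
  linarith [hA, hB, hC, hE']

/-- **Crude bound** (any shift): `‖Inner(u)‖ ≤ U (2 + 2(T' + U) + 2|u|) Σ ‖a_n‖` for `T' ≥ 0`, `U ≥ 0`.
[folklore] -/
theorem UniversalFactor.narrowInner_crude_le (P : ℕ) (a : ℕ → ℂ) {T' U : ℝ} (hT' : 0 ≤ T') (hU : 0 ≤ U) (u : ℝ) :
    ‖∫ t in T'..(T' + U), (hardyZ (t + u) : ℂ) *
        (conj (thetaMainPhase t) * ∑ n ∈ Finset.Icc 1 P, a n * (n : ℂ) ^ ((t : ℂ) * I))‖ ≤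
      U * (2 + 2 * (T' + U) + 2 * |u|) * ∑ n ∈ Finset.Icc 1 P, ‖a n‖ := by
  have hle : T' ≤ T' + U := by linarith
  have hbound : ∀ t ∈ uIoc T' (T' + U), ‖(hardyZ (t + u) : ℂ) *
      (conj (thetaMainPhase t) * ∑ n ∈ Finset.Icc 1 P, a n * (n : ℂ) ^ ((t : ℂ) * I))‖ ≤
      (2 + 2 * (T' + U) + 2 * |u|) * ∑ n ∈ Finset.Icc 1 P, ‖a n‖ := by
    intro t ht
    rw [uIoc_of_le hle] at ht
    have ht0 : 0 ≤ t := hT'.trans ht.1.le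
    rw [norm_mul, norm_mul, Complex.norm_conj, norm_thetaMainPhase, one_mul]
    have hZ := UniversalFactor.norm_hardyZ_le_linear (t + u)
    have htu : |t + u| ≤ (T' + U) + |u| := (abs_add_le t u).trans (by rw [abs_of_nonneg ht0]; linarith [ht.2])
    have hDn : ‖∑ n ∈ Finset.Icc 1 P, a n * (n : ℂ) ^ ((t : ℂ) * I)‖ ≤ ∑ n ∈ Finset.Icc 1 P, ‖a n‖ := by
      refine (norm_sum_le _ _).trans (Finset.sum_le_sum fun n hn => ?_)
      rw [norm_mul, SWTools.norm_natCast_cpow_mul_I (Finset.mem_Icc.1 hn).1, mul_one]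
    exact mul_le_mul (hZ.trans (by linarith)) hDn (norm_nonneg _) (by positivity)
  have := intervalIntegral.norm_integral_le_of_norm_le_const hbound
  rw [abs_of_nonneg (by linarith : (0:ℝ) ≤ T' + U - T'), show T' + U - T' = U by ring] at this
  linarith [this]

/-- Registered sub-stub `narrowInner_smooth_continuous` of crux `stmt-RiemannHypothesis-2576` (binder-free restatement of
`UniversalFactor.narrowSmooth_continuous`, used by the gate to attach this helper file to the crux). [folklore] -/
theorem UniversalFactor.narrowInner_smooth_continuous : ∀ {a : ℝ}, Real.pi / 8 < a → Continuous fun t : ℝ => ∫ u : ℝ, Real.exp (-(2 * a * |u|)) * Real.exp (-(Real.pi * u / 4)) * hardyZ (t + u) :=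
  fun ha => UniversalFactor.narrowSmooth_continuous ha

end Summit.RiemannHypothesis.RiemannHypothesis.Theorems
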